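import Summits.Ventures.PercRepro2.CaseOneGadgetUWOB

/-!
# The gadget `u ~ {w, o}`, `w ~ {u, a₁, a₂, b}` — pointwise structure (the uwo shape)
(blind cell PercRepro2, p1 g25; S5 §2.1 (K9): the third unmarked-neighbour shape, the structural
layer for its four certificate chains — P1-G24 §4 (2))

`IsGadgetUWO`: the five edges `euw = {w, u}`, `euo = {o, u}`, `ewa1 = {a₁, w}`, `ewa2 = {a₂, w}`,
`ewb = {b, w}` are all the edges at `u` and at `w`. With all five closed both centres are isolated
(`base5O`); the bridge invariant of `CaseOneStar.lean` is applied TWICE: stage 1 opens the three edges of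
`w` to `a₁, a₂, b` (centre `w` over the base; `u` is still isolated), stage 2 opens the two edges of `u`
(centre `u` over the stage-1 configuration). So **`conn_open5O_iff`** reads a connection among vertices
`≠ u` in `open5O` as a connection in the stage-1 configuration or one through `u` via two open
neighbours of `u` (in `{w, o}`), and **`conn_stage1O_iff`** / **`conn_stage1O_w_iff`** read the stage-1
connections in the base (`w` bridges its open neighbours among `a₁, a₂, b`). The same architecture as
`CaseOneGadgetUWA1.lean` (`u ~ {w, a₁}`, `w ~ {u, a₂, o, b}`) with the root `a₁` and the mark `o`
exchanged between the two centres (`bridgeInv_of_isolated` of `CaseOneGadgetUWOB.lean` reused); the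
pinning, the cells and the masses are generated from these lemmas. Own code; standard axioms. -/

namespace Summit.Ventures.PercRepro2

namespace CaseOne

section GadgetUWO
variable {V : Type*} {E : Type*} [DecidableEq E]

/-- **The gadget**: `u`'s edges are exactly `euw, euo` and `w`'s edges exactly `euw, ewa1, ewa2, ewb`. -/
structure IsGadgetUWO (ends : E → Sym2 V) (o a₁ a₂ b u w : V) (euw euo ewa1 ewa2 ewb : E) : Prop where
  /-- the edge `{w, u}` -/
  ends_uw : ends euw = s(w, u)
  /-- the edge `{o, u}` -/
  ends_uo : ends euo = s(o, u)
  /-- the edge `{a₁, w}` -/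
  ends_wa1 : ends ewa1 = s(a₁, w)
  /-- the edge `{a₂, w}` -/
  ends_wa2 : ends ewa2 = s(a₂, w)
  /-- the edge `{b, w}` -/
  ends_wb : ends ewb = s(b, w)
  /-- distinct edges -/
  ne_uw_uo : euw ≠ euo
  /-- distinct edges -/
  ne_uw_wa1 : euw ≠ ewa1
  /-- distinct edges -/
  ne_uw_wa2 : euw ≠ ewa2
  /-- distinct edges -/
  ne_uw_wb : euw ≠ ewb
  /-- distinct edges -/
  ne_uo_wa1 : euo ≠ ewa1
  /-- distinct edges -/
  ne_uo_wa2 : euo ≠ ewa2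
  /-- distinct edges -/
  ne_uo_wb : euo ≠ ewb
  /-- distinct edges -/
  ne_wa1_wa2 : ewa1 ≠ ewa2
  /-- distinct edges -/
  ne_wa1_wb : ewa1 ≠ ewb
  /-- distinct edges -/
  ne_wa2_wb : ewa2 ≠ ewb
  /-- no other edge at `u` -/
  unique_u : ∀ e, u ∈ ends e → e = euw ∨ e = euo
  /-- no other edge at `w` -/
  unique_w : ∀ e, w ∈ ends e → e = euw ∨ e = ewa1 ∨ e = ewa2 ∨ e = ewb
  /-- `w ≠ u` -/
  ne_wu : w ≠ u
  /-- `o ≠ u` -/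
  ne_ou : o ≠ u
  /-- `b ≠ u` -/
  ne_bu : b ≠ u
  /-- `a₁ ≠ u` -/
  ne_a1u : a₁ ≠ u
  /-- `a₂ ≠ u` -/
  ne_a2u : a₂ ≠ u
  /-- `a₁ ≠ w` -/
  ne_a1w : a₁ ≠ w
  /-- `a₂ ≠ w` -/
  ne_a2w : a₂ ≠ w
  /-- `o ≠ w` -/
  ne_ow : o ≠ w
  /-- `b ≠ w` -/
  ne_bw : b ≠ w

variable {ends : E → Sym2 V} {o a₁ a₂ b u w : V} {euw euo ewa1 ewa2 ewb : E}

/-- The configuration with the five gadget edges closed. -/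
def base5O (euw euo ewa1 ewa2 ewb : E) (ω : Config E) : Config E :=
  Function.update (Function.update (Function.update (Function.update (Function.update ω euw false) euo false)
    ewa1 false) ewa2 false) ewb false

/-- The stage-1 configuration: the three edges of `w` in the states `c₁, c₂, cb` (from the base). -/
def stage1O (euw euo ewa1 ewa2 ewb : E) (c₁ c₂ cb : Bool) (ω : Config E) : Config E :=
  Function.update (Function.update (Function.update (base5O euw euo ewa1 ewa2 ewb ω) ewa1 c₁) ewa2 c₂) ewb cb

/-- The configuration with the five gadget edges in the states `(cw, co)` at `u` and `(c₁, c₂, cb)` at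
`w`. -/
def open5O (euw euo ewa1 ewa2 ewb : E) (cw co c₁ c₂ cb : Bool) (ω : Config E) : Config E :=
  Function.update (Function.update (stage1O euw euo ewa1 ewa2 ewb c₁ c₂ cb ω) euw cw) euo co

/-- The open neighbours of `w` among `a₁, a₂, b`. -/
def nbrWO (a₁ a₂ b : V) (c₁ c₂ cb : Bool) (v : V) : Prop :=
  (c₁ = true ∧ v = a₁) ∨ (c₂ = true ∧ v = a₂) ∨ (cb = true ∧ v = b)

/-- The open neighbours of `u` among `w, o`. -/
def nbrUO (w o : V) (cw co : Bool) (v : V) : Prop := (cw = true ∧ v = w) ∨ (co = true ∧ v = o)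

omit [DecidableEq E] in
/-- With its two edges closed, `u` is isolated. -/
lemma isolated_uO (h : IsGadgetUWO ends o a₁ a₂ b u w euw euo ewa1 ewa2 ewb) {ω : Config E}
    (h1 : ω euw = false) (h2 : ω euo = false) {x : V} (hx : Conn ends ω u x) : x = u := by
  have hS : ∀ y ∈ ({u} : Set V), ∀ z, (openGraph ends ω).Adj y z → z ∈ ({u} : Set V) := by
    intro y hy z hyz
    rw [Set.mem_singleton_iff] at hy
    rw [hy] at hyz
    obtain ⟨_, e, he, hends⟩ := openGraph_adj.1 hyz
    have hu : u ∈ ends e := by rw [hends]; exact Sym2.mem_mk_left _ _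
    rcases h.unique_u e hu with rfl | rfl
    · rw [h1] at he; exact Bool.noConfusion he
    · rw [h2] at he; exact Bool.noConfusion he
  exact mem_of_conn_of_closed hS (Set.mem_singleton u) hx

omit [DecidableEq E] in
/-- With its four edges closed, `w` is isolated. -/
lemma isolated_wO (h : IsGadgetUWO ends o a₁ a₂ b u w euw euo ewa1 ewa2 ewb) {ω : Config E}
    (h1 : ω euw = false) (h2 : ω ewa1 = false) (h3 : ω ewa2 = false) (h4 : ω ewb = false) {x : V}
    (hx : Conn ends ω w x) : x = w := by
  have hS : ∀ y ∈ ({w} : Set V), ∀ z, (openGraph ends ω).Adj y z → z ∈ ({w} : Set V) := by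
    intro y hy z hyz
    rw [Set.mem_singleton_iff] at hy
    rw [hy] at hyz
    obtain ⟨_, e, he, hends⟩ := openGraph_adj.1 hyz
    have hw : w ∈ ends e := by rw [hends]; exact Sym2.mem_mk_left _ _
    rcases h.unique_w e hw with rfl | rfl | rfl | rfl
    · rw [h1] at he; exact Bool.noConfusion he
    · rw [h2] at he; exact Bool.noConfusion he
    · rw [h3] at he; exact Bool.noConfusion he
    · rw [h4] at he; exact Bool.noConfusion he
  exact mem_of_conn_of_closed hS (Set.mem_singleton w) hx

/-- `base5O` has the five edges closed. -/
lemma base5O_uw (h : IsGadgetUWO ends o a₁ a₂ b u w euw euo ewa1 ewa2 ewb) (ω : Config E) :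
    base5O euw euo ewa1 ewa2 ewb ω euw = false := by
  simp [base5O, Function.update_of_ne h.ne_uw_wb, Function.update_of_ne h.ne_uw_wa2,
    Function.update_of_ne h.ne_uw_wa1, Function.update_of_ne h.ne_uw_uo]

/-- `base5O` has the five edges closed. -/
lemma base5O_uo (h : IsGadgetUWO ends o a₁ a₂ b u w euw euo ewa1 ewa2 ewb) (ω : Config E) :
    base5O euw euo ewa1 ewa2 ewb ω euo = false := by
  simp [base5O, Function.update_of_ne h.ne_uo_wb, Function.update_of_ne h.ne_uo_wa2,
    Function.update_of_ne h.ne_uo_wa1]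

/-- `base5O` has the five edges closed. -/
lemma base5O_wa1 (h : IsGadgetUWO ends o a₁ a₂ b u w euw euo ewa1 ewa2 ewb) (ω : Config E) :
    base5O euw euo ewa1 ewa2 ewb ω ewa1 = false := by
  simp [base5O, Function.update_of_ne h.ne_wa1_wb, Function.update_of_ne h.ne_wa1_wa2]

/-- `base5O` has the five edges closed. -/
lemma base5O_wa2 (h : IsGadgetUWO ends o a₁ a₂ b u w euw euo ewa1 ewa2 ewb) (ω : Config E) :
    base5O euw euo ewa1 ewa2 ewb ω ewa2 = false := by
  simp [base5O, Function.update_of_ne h.ne_wa2_wb]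

/-- `base5O` has the five edges closed. -/
lemma base5O_wb (ω : Config E) : base5O euw euo ewa1 ewa2 ewb ω ewb = false := by simp [base5O]

/-- The stage-1 configuration has the two edges of `u` closed. -/
lemma stage1O_uw (h : IsGadgetUWO ends o a₁ a₂ b u w euw euo ewa1 ewa2 ewb) (c₁ c₂ cb : Bool)
    (ω : Config E) : stage1O euw euo ewa1 ewa2 ewb c₁ c₂ cb ω euw = false := by
  simp [stage1O, Function.update_of_ne h.ne_uw_wb, Function.update_of_ne h.ne_uw_wa2,
    Function.update_of_ne h.ne_uw_wa1, base5O_uw h ω]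

/-- The stage-1 configuration has the two edges of `u` closed. -/
lemma stage1O_uo (h : IsGadgetUWO ends o a₁ a₂ b u w euw euo ewa1 ewa2 ewb) (c₁ c₂ cb : Bool)
    (ω : Config E) : stage1O euw euo ewa1 ewa2 ewb c₁ c₂ cb ω euo = false := by
  simp [stage1O, Function.update_of_ne h.ne_uo_wb, Function.update_of_ne h.ne_uo_wa2,
    Function.update_of_ne h.ne_uo_wa1, base5O_uo h ω]

/-- **Stage 1: `w` bridges its open neighbours among `a₁, a₂, b`** over the base. -/
theorem bridgeInv_stage1O (h : IsGadgetUWO ends o a₁ a₂ b u w euw euo ewa1 ewa2 ewb) (ω : Config E)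
    (c₁ c₂ cb : Bool) :
    BridgeInv ends w (base5O euw euo ewa1 ewa2 ewb ω) (stage1O euw euo ewa1 ewa2 ewb c₁ c₂ cb ω)
      (nbrWO a₁ a₂ b c₁ c₂ cb) := by
  have s0 : BridgeInv ends w (base5O euw euo ewa1 ewa2 ewb ω) (base5O euw euo ewa1 ewa2 ewb ω)
      (fun _ => False) :=
    bridgeInv_of_isolated fun x hx hc =>
      hx (isolated_wO h (base5O_uw h ω) (base5O_wa1 h ω) (base5O_wa2 h ω) (base5O_wb ω) (conn_symm hc))
  have s1 := bridgeInv_flag h.ends_wa1 h.ne_a1w s0 c₁ (base5O_wa1 h ω)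
  have s2 := bridgeInv_flag h.ends_wa2 h.ne_a2w s1 c₂
    (by rw [Function.update_of_ne h.ne_wa1_wa2.symm]; exact base5O_wa2 h ω)
  have s3 := bridgeInv_flag h.ends_wb h.ne_bw s2 cb
    (by rw [Function.update_of_ne h.ne_wa2_wb.symm, Function.update_of_ne h.ne_wa1_wb.symm]
        exact base5O_wb ω)
  refine bridgeInv_congr (fun v => ?_) s3
  unfold nbrWO
  tauto

/-- **Stage 2: `u` bridges its open neighbours among `w, o`** over the stage-1 configuration. -/
theorem bridgeInv_open5O (h : IsGadgetUWO ends o a₁ a₂ b u w euw euo ewa1 ewa2 ewb) (ω : Config E)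
    (cw co c₁ c₂ cb : Bool) :
    BridgeInv ends u (stage1O euw euo ewa1 ewa2 ewb c₁ c₂ cb ω)
      (open5O euw euo ewa1 ewa2 ewb cw co c₁ c₂ cb ω) (nbrUO w o cw co) := by
  have s0 : BridgeInv ends u (stage1O euw euo ewa1 ewa2 ewb c₁ c₂ cb ω)
      (stage1O euw euo ewa1 ewa2 ewb c₁ c₂ cb ω) (fun _ => False) :=
    bridgeInv_of_isolated fun x hx hc =>
      hx (isolated_uO h (stage1O_uw h c₁ c₂ cb ω) (stage1O_uo h c₁ c₂ cb ω) (conn_symm hc))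
  have s1 := bridgeInv_flag h.ends_uw h.ne_wu s0 cw (stage1O_uw h c₁ c₂ cb ω)
  have s2 := bridgeInv_flag h.ends_uo h.ne_ou s1 co
    (by rw [Function.update_of_ne h.ne_uw_uo.symm]; exact stage1O_uo h c₁ c₂ cb ω)
  refine bridgeInv_congr (fun v => ?_) s2
  unfold nbrUO
  tauto

/-- **Connections among vertices `≠ u`** in `open5O`: in the stage-1 configuration, or through `u` via
two open neighbours of `u`. -/
theorem conn_open5O_iff (h : IsGadgetUWO ends o a₁ a₂ b u w euw euo ewa1 ewa2 ewb) (ω : Config E)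
    (cw co c₁ c₂ cb : Bool) {x y : V} (hx : x ≠ u) (hy : y ≠ u) :
    Conn ends (open5O euw euo ewa1 ewa2 ewb cw co c₁ c₂ cb ω) x y ↔
      Conn ends (stage1O euw euo ewa1 ewa2 ewb c₁ c₂ cb ω) x y ∨
        ∃ u' v', nbrUO w o cw co u' ∧ nbrUO w o cw co v' ∧
          Conn ends (stage1O euw euo ewa1 ewa2 ewb c₁ c₂ cb ω) x u' ∧
          Conn ends (stage1O euw euo ewa1 ewa2 ewb c₁ c₂ cb ω) v' y :=
  (bridgeInv_open5O h ω cw co c₁ c₂ cb).1 x y hx hy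

/-- **Connections to `u`** in `open5O`: `x ↔ u` iff `x ↔ u'` in the stage-1 configuration for an open
neighbour `u'` of `u`. -/
theorem conn_open5O_u_iff (h : IsGadgetUWO ends o a₁ a₂ b u w euw euo ewa1 ewa2 ewb) (ω : Config E)
    (cw co c₁ c₂ cb : Bool) {x : V} (hx : x ≠ u) :
    Conn ends (open5O euw euo ewa1 ewa2 ewb cw co c₁ c₂ cb ω) x u ↔
      ∃ u', nbrUO w o cw co u' ∧ Conn ends (stage1O euw euo ewa1 ewa2 ewb c₁ c₂ cb ω) x u' :=
  (bridgeInv_open5O h ω cw co c₁ c₂ cb).2 x hx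

/-- **Stage-1 connections among vertices `≠ w`**: in the base, or through `w` via two open neighbours
of `w`. -/
theorem conn_stage1O_iff (h : IsGadgetUWO ends o a₁ a₂ b u w euw euo ewa1 ewa2 ewb) (ω : Config E)
    (c₁ c₂ cb : Bool) {x y : V} (hx : x ≠ w) (hy : y ≠ w) :
    Conn ends (stage1O euw euo ewa1 ewa2 ewb c₁ c₂ cb ω) x y ↔
      Conn ends (base5O euw euo ewa1 ewa2 ewb ω) x y ∨
        ∃ u' v', nbrWO a₁ a₂ b c₁ c₂ cb u' ∧ nbrWO a₁ a₂ b c₁ c₂ cb v' ∧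
          Conn ends (base5O euw euo ewa1 ewa2 ewb ω) x u' ∧
          Conn ends (base5O euw euo ewa1 ewa2 ewb ω) v' y :=
  (bridgeInv_stage1O h ω c₁ c₂ cb).1 x y hx hy

/-- **Stage-1 connections to `w`**: `x ↔ w` iff `x ↔ u'` in the base for an open neighbour `u'` of
`w`. -/
theorem conn_stage1O_w_iff (h : IsGadgetUWO ends o a₁ a₂ b u w euw euo ewa1 ewa2 ewb) (ω : Config E)
    (c₁ c₂ cb : Bool) {x : V} (hx : x ≠ w) :
    Conn ends (stage1O euw euo ewa1 ewa2 ewb c₁ c₂ cb ω) x w ↔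
      ∃ u', nbrWO a₁ a₂ b c₁ c₂ cb u' ∧ Conn ends (base5O euw euo ewa1 ewa2 ewb ω) x u' :=
  (bridgeInv_stage1O h ω c₁ c₂ cb).2 x hx

/-- **Stage-1 connections from `w`** (the centre first). -/
theorem conn_stage1O_w_iff' (h : IsGadgetUWO ends o a₁ a₂ b u w euw euo ewa1 ewa2 ewb) (ω : Config E)
    (c₁ c₂ cb : Bool) {y : V} (hy : y ≠ w) :
    Conn ends (stage1O euw euo ewa1 ewa2 ewb c₁ c₂ cb ω) w y ↔
      ∃ u', nbrWO a₁ a₂ b c₁ c₂ cb u' ∧ Conn ends (base5O euw euo ewa1 ewa2 ewb ω) y u' := by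
  constructor
  · intro hc
    exact (conn_stage1O_w_iff h ω c₁ c₂ cb hy).1 (conn_symm hc)
  · intro hc
    exact conn_symm ((conn_stage1O_w_iff h ω c₁ c₂ cb hy).2 hc)

/-- **Connections from `u`** in `open5O` (the centre first). -/
theorem conn_open5O_u_iff' (h : IsGadgetUWO ends o a₁ a₂ b u w euw euo ewa1 ewa2 ewb) (ω : Config E)
    (cw co c₁ c₂ cb : Bool) {y : V} (hy : y ≠ u) :
    Conn ends (open5O euw euo ewa1 ewa2 ewb cw co c₁ c₂ cb ω) u y ↔
      ∃ u', nbrUO w o cw co u' ∧ Conn ends (stage1O euw euo ewa1 ewa2 ewb c₁ c₂ cb ω) y u' := by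
  constructor
  · intro hc
    exact (conn_open5O_u_iff h ω cw co c₁ c₂ cb hy).1 (conn_symm hc)
  · intro hc
    exact conn_symm ((conn_open5O_u_iff h ω cw co c₁ c₂ cb hy).2 hc)

/-- In the base, `u` is joined to nothing but itself. -/
lemma not_conn_base5O_u (h : IsGadgetUWO ends o a₁ a₂ b u w euw euo ewa1 ewa2 ewb) (ω : Config E)
    {x : V} (hx : x ≠ u) : ¬ Conn ends (base5O euw euo ewa1 ewa2 ewb ω) x u :=
  fun hc => hx (isolated_uO h (base5O_uw h ω) (base5O_uo h ω) (conn_symm hc))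

/-- In the base, `w` is joined to nothing but itself. -/
lemma not_conn_base5O_w (h : IsGadgetUWO ends o a₁ a₂ b u w euw euo ewa1 ewa2 ewb) (ω : Config E)
    {x : V} (hx : x ≠ w) : ¬ Conn ends (base5O euw euo ewa1 ewa2 ewb ω) x w :=
  fun hc => hx (isolated_wO h (base5O_uw h ω) (base5O_wa1 h ω) (base5O_wa2 h ω) (base5O_wb ω)
    (conn_symm hc))

/-- The base equals `ω` when the five edges are closed in `ω`. -/
lemma base5O_eq_self {ω : Config E} (h1 : ω euw = false) (h2 : ω euo = false) (h3 : ω ewa1 = false)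
    (h4 : ω ewa2 = false) (h5 : ω ewb = false) : base5O euw euo ewa1 ewa2 ewb ω = ω := by
  funext e
  simp only [base5O, Function.update_apply]
  split_ifs <;> simp_all

end GadgetUWO

end CaseOne

end Summit.Ventures.PercRepro2
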